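import Summits.NavierStokesRegularity.NavierStokesRegularity.Theorems.PoloidalWindowDoorPoloidalWindowRigidityZShockRotatingProfile
import HarnessLib

/-!
# Crux K2 `PoloidalWindowRigidity` (stmt-NavierStokesRegularity-19708), line `z_shock` — R3 inhabitant census: ROTATING PATTERNS of the
# autonomous thick height-evolution (III) — the converse: every solution of the profile equation generates a rotating solution of the slice
# equation at EVERY height (rotation covariance of the divergence form)

`--supports stmt-NavierStokesRegularity-19708 --as helper` (leafhand-ns-poloidalwindowdoor-3 g9, cell decomp-ns, 2026-08-31).  Class-free,
def-free; Mathlib + part I (`…ZShockRotatingProfile`).  **No stub and no summit is closed by this file; Navier–Stokes regularity is NOT proved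
here (rung 0).**

WHY THIS FILE.  Part I showed: if the rotating pattern `W(s, y) = Ψ(R_{ωs} y)` solves the autonomous slice equation `∂ₛ∂ₛW = Σᵢ ∂ᵢ(γ(W)∂ᵢW)`
(tree `…ZShockSliceTyping.slice_wave_pde`) at height `0`, then `Ψ` solves the profile equation `ω² ΘΘΨ = Σᵢ ∂ᵢ(γ(Ψ)∂ᵢΨ)`.  For the census item
«rotating patterns [L]» to be a FAITHFUL inhabitant class of the autonomous thick column (the disprover's reading: a bounded non-radial profile
would refute the two-sided rigidity R3 outright) one also needs the converse, which is the content of this file: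

* `hasFDerivAt_rot` — the rotation `y ↦ R_a y = (cos a·y₀ − sin a·y₁, sin a·y₀ + cos a·y₁)` is differentiable with derivative `h ↦ R_a h`;
* `fderiv_comp_rot` — chain rule `D(Ψ ∘ R_a)(y)[h] = DΨ(R_a y)[R_a h]`, and in coordinates
  `∂₀(Ψ∘R_a) = cos a·(∂₀Ψ)∘R_a + sin a·(∂₁Ψ)∘R_a`, `∂₁(Ψ∘R_a) = −sin a·(∂₀Ψ)∘R_a + cos a·(∂₁Ψ)∘R_a` (`fderiv_comp_rot_zero/one`);
* ★ `divForm_comp_rot` — **rotation covariance of the divergence form**: for `C²` `Ψ` and `C¹` `γ`,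
  `Σᵢ ∂ᵢ(γ(Ψ∘R_a) ∂ᵢ(Ψ∘R_a))(y) = Σᵢ ∂ᵢ(γ(Ψ) ∂ᵢΨ)(R_a y)` (expand in the atoms `∂ᵢΨ, ∂ⱼ∂ᵢΨ, γ, γ'` at `R_a y`; the identity is
  `cos² + sin² = 1` times the unrotated expression);
* ★ `rotating_slice_solution_of_profile` — **the converse.**  If the `C²` profile solves `ω² ΘΘΨ = Σᵢ ∂ᵢ(γ(Ψ)∂ᵢΨ)` on the plane, then the
  rotating pattern solves the slice equation at EVERY height `s` and every `y`:
  `∂ₛ∂ₛ[Ψ(R_{ωs}y)] = Σᵢ ∂ᵢ(γ(Ψ∘R_{ωs}) ∂ᵢ(Ψ∘R_{ωs}))(y)` — part I's `deriv_deriv_comp_rotOrbit` for the left side, `divForm_comp_rot` for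
  the right side.  Together with part I: rotating solutions of the autonomous height-evolution ⟺ solutions of the profile equation.

Elementary multivariable calculus; no rigidity is proved.  presearch: none needed beyond part I (calculus bookkeeping). [folklore]
-/

noncomputable section

namespace Summit.NavierStokesRegularity.NavierStokesRegularity.Theorems.PoloidalWindowDoorPoloidalWindowRigidityZShockRotatingProfileSlice

-- the summit and its single sub-problem share the name (CONVENTIONS §1)
set_option linter.dupNamespace false

open Set Filter Topology Function
open Summit.NavierStokesRegularity.NavierStokesRegularity.Theorems.PoloidalWindowDoorPoloidalWindowRigidityZShockRotatingProfile

variable {Ψ : EuclideanSpace ℝ (Fin 2) → ℝ} {γ : ℝ → ℝ} {ω a : ℝ}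
  {R : EuclideanSpace ℝ (Fin 2) → EuclideanSpace ℝ (Fin 2)} {J : EuclideanSpace ℝ (Fin 2) → EuclideanSpace ℝ (Fin 2)}

/-! ### The rotation by a fixed angle -/

/-- Coordinates of the rotated point. [folklore] -/
theorem rot_apply_zero
    (hR : ∀ y : EuclideanSpace ℝ (Fin 2), R y = (Real.cos a * y 0 - Real.sin a * y 1) • EuclideanSpace.single (0 : Fin 2) (1 : ℝ) +
      (Real.sin a * y 0 + Real.cos a * y 1) • EuclideanSpace.single (1 : Fin 2) (1 : ℝ))
    (y : EuclideanSpace ℝ (Fin 2)) : R y 0 = Real.cos a * y 0 - Real.sin a * y 1 := by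
  rw [hR]; simp

/-- Coordinates of the rotated point. [folklore] -/
theorem rot_apply_one
    (hR : ∀ y : EuclideanSpace ℝ (Fin 2), R y = (Real.cos a * y 0 - Real.sin a * y 1) • EuclideanSpace.single (0 : Fin 2) (1 : ℝ) +
      (Real.sin a * y 0 + Real.cos a * y 1) • EuclideanSpace.single (1 : Fin 2) (1 : ℝ))
    (y : EuclideanSpace ℝ (Fin 2)) : R y 1 = Real.sin a * y 0 + Real.cos a * y 1 := by
  rw [hR]; simp

/-- **The rotation is differentiable with derivative `h ↦ R h`** (it is linear): `HasFDerivAt R L y` for a continuous linear `L` with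
`L h = R h`. [folklore] -/
theorem hasFDerivAt_rot
    (hR : ∀ y : EuclideanSpace ℝ (Fin 2), R y = (Real.cos a * y 0 - Real.sin a * y 1) • EuclideanSpace.single (0 : Fin 2) (1 : ℝ) +
      (Real.sin a * y 0 + Real.cos a * y 1) • EuclideanSpace.single (1 : Fin 2) (1 : ℝ))
    (y : EuclideanSpace ℝ (Fin 2)) :
    ∃ L : EuclideanSpace ℝ (Fin 2) →L[ℝ] EuclideanSpace ℝ (Fin 2), HasFDerivAt R L y ∧ ∀ h, L h = R h := by
  have hR' : R = fun y => (Real.cos a * y 0 - Real.sin a * y 1) • EuclideanSpace.single (0 : Fin 2) (1 : ℝ) +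
      (Real.sin a * y 0 + Real.cos a * y 1) • EuclideanSpace.single (1 : Fin 2) (1 : ℝ) := funext hR
  have hP0 := hasFDerivAt_coord_zero y
  have hP1 := hasFDerivAt_coord_one y
  have h : HasFDerivAt (fun y : EuclideanSpace ℝ (Fin 2) =>
      (Real.cos a * y 0 - Real.sin a * y 1) • EuclideanSpace.single (0 : Fin 2) (1 : ℝ) +
        (Real.sin a * y 0 + Real.cos a * y 1) • EuclideanSpace.single (1 : Fin 2) (1 : ℝ))
      ((Real.cos a • (EuclideanSpace.proj (𝕜 := ℝ) (0 : Fin 2) : EuclideanSpace ℝ (Fin 2) →L[ℝ] ℝ) -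
          Real.sin a • (EuclideanSpace.proj (𝕜 := ℝ) (1 : Fin 2) : EuclideanSpace ℝ (Fin 2) →L[ℝ] ℝ)).smulRight
          (EuclideanSpace.single (0 : Fin 2) (1 : ℝ)) +
        (Real.sin a • (EuclideanSpace.proj (𝕜 := ℝ) (0 : Fin 2) : EuclideanSpace ℝ (Fin 2) →L[ℝ] ℝ) +
          Real.cos a • (EuclideanSpace.proj (𝕜 := ℝ) (1 : Fin 2) : EuclideanSpace ℝ (Fin 2) →L[ℝ] ℝ)).smulRight
          (EuclideanSpace.single (1 : Fin 2) (1 : ℝ))) y :=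
    (((hP0.const_mul (Real.cos a)).sub (hP1.const_mul (Real.sin a))).smul_const
      (EuclideanSpace.single (0 : Fin 2) (1 : ℝ))).add
    (((hP0.const_mul (Real.sin a)).add (hP1.const_mul (Real.cos a))).smul_const (EuclideanSpace.single (1 : Fin 2) (1 : ℝ)))
  refine ⟨(Real.cos a • (EuclideanSpace.proj (𝕜 := ℝ) (0 : Fin 2) : EuclideanSpace ℝ (Fin 2) →L[ℝ] ℝ) -
          Real.sin a • (EuclideanSpace.proj (𝕜 := ℝ) (1 : Fin 2) : EuclideanSpace ℝ (Fin 2) →L[ℝ] ℝ)).smulRight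
          (EuclideanSpace.single (0 : Fin 2) (1 : ℝ)) +
        (Real.sin a • (EuclideanSpace.proj (𝕜 := ℝ) (0 : Fin 2) : EuclideanSpace ℝ (Fin 2) →L[ℝ] ℝ) +
          Real.cos a • (EuclideanSpace.proj (𝕜 := ℝ) (1 : Fin 2) : EuclideanSpace ℝ (Fin 2) →L[ℝ] ℝ)).smulRight
          (EuclideanSpace.single (1 : Fin 2) (1 : ℝ)), ?_, fun h' => ?_⟩
  · rw [hR']
    exact h
  · rw [hR h']
    ext i
    fin_cases i <;> simp

/-- **Chain rule through the rotation**: `D(Ψ ∘ R)(y)[h] = DΨ(R y)[R h]`. [folklore] -/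
theorem fderiv_comp_rot (hΨd : Differentiable ℝ Ψ)
    (hR : ∀ y : EuclideanSpace ℝ (Fin 2), R y = (Real.cos a * y 0 - Real.sin a * y 1) • EuclideanSpace.single (0 : Fin 2) (1 : ℝ) +
      (Real.sin a * y 0 + Real.cos a * y 1) • EuclideanSpace.single (1 : Fin 2) (1 : ℝ))
    (y h : EuclideanSpace ℝ (Fin 2)) : fderiv ℝ (fun y' => Ψ (R y')) y h = fderiv ℝ Ψ (R y) (R h) := by
  obtain ⟨L, hL, hLR⟩ := hasFDerivAt_rot hR y
  have hc : HasFDerivAt (fun y' => Ψ (R y')) ((fderiv ℝ Ψ (R y)).comp L) y := (hΨd (R y)).hasFDerivAt.comp y hL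
  rw [hc.fderiv, ContinuousLinearMap.comp_apply, hLR]

/-- `∂₀(Ψ ∘ R) = cos a · (∂₀Ψ) ∘ R + sin a · (∂₁Ψ) ∘ R`. [folklore] -/
theorem fderiv_comp_rot_zero (hΨd : Differentiable ℝ Ψ)
    (hR : ∀ y : EuclideanSpace ℝ (Fin 2), R y = (Real.cos a * y 0 - Real.sin a * y 1) • EuclideanSpace.single (0 : Fin 2) (1 : ℝ) +
      (Real.sin a * y 0 + Real.cos a * y 1) • EuclideanSpace.single (1 : Fin 2) (1 : ℝ))
    (y : EuclideanSpace ℝ (Fin 2)) :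
    fderiv ℝ (fun y' => Ψ (R y')) y (EuclideanSpace.single 0 1) =
      Real.cos a * fderiv ℝ Ψ (R y) (EuclideanSpace.single 0 1) + Real.sin a * fderiv ℝ Ψ (R y) (EuclideanSpace.single 1 1) := by
  rw [fderiv_comp_rot hΨd hR, fderiv_apply_coord (R y) (R _), rot_apply_zero hR, rot_apply_one hR]
  simp

/-- `∂₁(Ψ ∘ R) = −sin a · (∂₀Ψ) ∘ R + cos a · (∂₁Ψ) ∘ R`. [folklore] -/
theorem fderiv_comp_rot_one (hΨd : Differentiable ℝ Ψ)
    (hR : ∀ y : EuclideanSpace ℝ (Fin 2), R y = (Real.cos a * y 0 - Real.sin a * y 1) • EuclideanSpace.single (0 : Fin 2) (1 : ℝ) +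
      (Real.sin a * y 0 + Real.cos a * y 1) • EuclideanSpace.single (1 : Fin 2) (1 : ℝ))
    (y : EuclideanSpace ℝ (Fin 2)) :
    fderiv ℝ (fun y' => Ψ (R y')) y (EuclideanSpace.single 1 1) =
      -Real.sin a * fderiv ℝ Ψ (R y) (EuclideanSpace.single 0 1) + Real.cos a * fderiv ℝ Ψ (R y) (EuclideanSpace.single 1 1) := by
  rw [fderiv_comp_rot hΨd hR, fderiv_apply_coord (R y) (R _), rot_apply_zero hR, rot_apply_one hR]
  simp

/-! ### Rotation covariance of the divergence form -/

/-- ★ **Rotation covariance of the divergence form.**  For `Ψ : ℝ² → ℝ` of class `C²`, `γ ∈ C¹` and the rotation `R = R_a`,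
`Σᵢ ∂ᵢ(γ(Ψ∘R) ∂ᵢ(Ψ∘R))(y) = Σᵢ ∂ᵢ(γ(Ψ) ∂ᵢΨ)(R y)`: both sides equal `γ'(Ψ)|∇Ψ|² + γ(Ψ) tr D²Ψ` at `R y`, the left one times
`cos²a + sin²a`. [folklore] -/
theorem divForm_comp_rot (hΨ : ContDiff ℝ 2 Ψ) (hγ : ContDiff ℝ 1 γ)
    (hR : ∀ y : EuclideanSpace ℝ (Fin 2), R y = (Real.cos a * y 0 - Real.sin a * y 1) • EuclideanSpace.single (0 : Fin 2) (1 : ℝ) +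
      (Real.sin a * y 0 + Real.cos a * y 1) • EuclideanSpace.single (1 : Fin 2) (1 : ℝ))
    (y : EuclideanSpace ℝ (Fin 2)) :
    ∑ i, fderiv ℝ (fun y' => γ (Ψ (R y')) * fderiv ℝ (fun y'' => Ψ (R y'')) y' (EuclideanSpace.single i 1)) y
        (EuclideanSpace.single i 1) =
      ∑ i, fderiv ℝ (fun x' => γ (Ψ x') * fderiv ℝ Ψ x' (EuclideanSpace.single i 1)) (R y) (EuclideanSpace.single i 1) := by
  -- regularity
  have hΨd : Differentiable ℝ Ψ := hΨ.differentiable two_ne_zero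
  have hDΨ : ContDiff ℝ 1 (fderiv ℝ Ψ) := hΨ.fderiv_right (m := 1) le_rfl
  set u₀ : EuclideanSpace ℝ (Fin 2) → ℝ := fun x' => fderiv ℝ Ψ x' (EuclideanSpace.single 0 1) with hu₀_def
  set u₁ : EuclideanSpace ℝ (Fin 2) → ℝ := fun x' => fderiv ℝ Ψ x' (EuclideanSpace.single 1 1) with hu₁_def
  have hu₀d : Differentiable ℝ u₀ := (hDΨ.clm_apply contDiff_const).differentiable one_ne_zero
  have hu₁d : Differentiable ℝ u₁ := (hDΨ.clm_apply contDiff_const).differentiable one_ne_zero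
  have hγd : Differentiable ℝ γ := hγ.differentiable one_ne_zero
  -- the rotation and the chain rules through it
  obtain ⟨L, hL, hLR⟩ := hasFDerivAt_rot hR y
  have hL0 : L (EuclideanSpace.single 0 1) 0 = Real.cos a ∧ L (EuclideanSpace.single 0 1) 1 = Real.sin a := by
    rw [hLR, rot_apply_zero hR, rot_apply_one hR]; simp
  have hL1 : L (EuclideanSpace.single 1 1) 0 = -Real.sin a ∧ L (EuclideanSpace.single 1 1) 1 = Real.cos a := by
    rw [hLR, rot_apply_zero hR, rot_apply_one hR]; simp
  have hγΨR : HasFDerivAt (fun y' => γ (Ψ (R y'))) (deriv γ (Ψ (R y)) • (fderiv ℝ Ψ (R y)).comp L) y :=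
    (hγd (Ψ (R y))).hasDerivAt.comp_hasFDerivAt y ((hΨd (R y)).hasFDerivAt.comp y hL)
  have hu₀R : HasFDerivAt (fun y' => u₀ (R y')) ((fderiv ℝ u₀ (R y)).comp L) y := (hu₀d (R y)).hasFDerivAt.comp y hL
  have hu₁R : HasFDerivAt (fun y' => u₁ (R y')) ((fderiv ℝ u₁ (R y)).comp L) y := (hu₁d (R y)).hasFDerivAt.comp y hL
  -- the rotated first derivatives, as functions
  have hf0 : (fun y' => γ (Ψ (R y')) * fderiv ℝ (fun y'' => Ψ (R y'')) y' (EuclideanSpace.single 0 1)) =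
      fun y' => γ (Ψ (R y')) * (Real.cos a * u₀ (R y') + Real.sin a * u₁ (R y')) := by
    funext y'; rw [fderiv_comp_rot_zero hΨd hR]
  have hf1 : (fun y' => γ (Ψ (R y')) * fderiv ℝ (fun y'' => Ψ (R y'')) y' (EuclideanSpace.single 1 1)) =
      fun y' => γ (Ψ (R y')) * (-Real.sin a * u₀ (R y') + Real.cos a * u₁ (R y')) := by
    funext y'; rw [fderiv_comp_rot_one hΨd hR]
  -- the rotated second derivatives
  have hF0 : HasFDerivAt (fun y' => γ (Ψ (R y')) * (Real.cos a * u₀ (R y') + Real.sin a * u₁ (R y')))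
      (γ (Ψ (R y)) • (Real.cos a • (fderiv ℝ u₀ (R y)).comp L + Real.sin a • (fderiv ℝ u₁ (R y)).comp L) +
        (Real.cos a * u₀ (R y) + Real.sin a * u₁ (R y)) • (deriv γ (Ψ (R y)) • (fderiv ℝ Ψ (R y)).comp L)) y :=
    hγΨR.mul ((hu₀R.const_mul _).add (hu₁R.const_mul _))
  have hF1 : HasFDerivAt (fun y' => γ (Ψ (R y')) * (-Real.sin a * u₀ (R y') + Real.cos a * u₁ (R y')))
      (γ (Ψ (R y)) • (-Real.sin a • (fderiv ℝ u₀ (R y)).comp L + Real.cos a • (fderiv ℝ u₁ (R y)).comp L) +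
        (-Real.sin a * u₀ (R y) + Real.cos a * u₁ (R y)) • (deriv γ (Ψ (R y)) • (fderiv ℝ Ψ (R y)).comp L)) y :=
    hγΨR.mul ((hu₀R.const_mul _).add (hu₁R.const_mul _))
  have hS0 : fderiv ℝ (fun y' => γ (Ψ (R y')) * fderiv ℝ (fun y'' => Ψ (R y'')) y' (EuclideanSpace.single 0 1)) y
      (EuclideanSpace.single 0 1) =
      γ (Ψ (R y)) * (Real.cos a * (Real.cos a * fderiv ℝ u₀ (R y) (EuclideanSpace.single 0 1) +
          Real.sin a * fderiv ℝ u₀ (R y) (EuclideanSpace.single 1 1)) +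
        Real.sin a * (Real.cos a * fderiv ℝ u₁ (R y) (EuclideanSpace.single 0 1) +
          Real.sin a * fderiv ℝ u₁ (R y) (EuclideanSpace.single 1 1))) +
      (Real.cos a * u₀ (R y) + Real.sin a * u₁ (R y)) *
        (deriv γ (Ψ (R y)) * (Real.cos a * u₀ (R y) + Real.sin a * u₁ (R y))) := by
    rw [hf0, hF0.fderiv]
    simp only [add_apply, smul_apply, smul_eq_mul, ContinuousLinearMap.comp_apply]
    rw [fderiv_apply_coord (Ψ := u₀) (R y) (L _), fderiv_apply_coord (Ψ := u₁) (R y) (L _),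
      fderiv_apply_coord (Ψ := Ψ) (R y) (L _), hL0.1, hL0.2]
  have hS1 : fderiv ℝ (fun y' => γ (Ψ (R y')) * fderiv ℝ (fun y'' => Ψ (R y'')) y' (EuclideanSpace.single 1 1)) y
      (EuclideanSpace.single 1 1) =
      γ (Ψ (R y)) * (-Real.sin a * (-Real.sin a * fderiv ℝ u₀ (R y) (EuclideanSpace.single 0 1) +
          Real.cos a * fderiv ℝ u₀ (R y) (EuclideanSpace.single 1 1)) +
        Real.cos a * (-Real.sin a * fderiv ℝ u₁ (R y) (EuclideanSpace.single 0 1) +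
          Real.cos a * fderiv ℝ u₁ (R y) (EuclideanSpace.single 1 1))) +
      (-Real.sin a * u₀ (R y) + Real.cos a * u₁ (R y)) *
        (deriv γ (Ψ (R y)) * (-Real.sin a * u₀ (R y) + Real.cos a * u₁ (R y))) := by
    rw [hf1, hF1.fderiv]
    simp only [add_apply, smul_apply, smul_eq_mul, ContinuousLinearMap.comp_apply]
    rw [fderiv_apply_coord (Ψ := u₀) (R y) (L _), fderiv_apply_coord (Ψ := u₁) (R y) (L _),
      fderiv_apply_coord (Ψ := Ψ) (R y) (L _), hL1.1, hL1.2]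
  -- the unrotated divergence at `R y`
  have hL' : ∀ i : Fin 2, fderiv ℝ (fun x' => γ (Ψ x') * fderiv ℝ Ψ x' (EuclideanSpace.single i 1)) (R y) (EuclideanSpace.single i 1) =
      γ (Ψ (R y)) * fderiv ℝ (fun x' => fderiv ℝ Ψ x' (EuclideanSpace.single i 1)) (R y) (EuclideanSpace.single i 1) +
        fderiv ℝ Ψ (R y) (EuclideanSpace.single i 1) * (deriv γ (Ψ (R y)) * fderiv ℝ Ψ (R y) (EuclideanSpace.single i 1)) := by
    intro i
    have hud : Differentiable ℝ fun x' => fderiv ℝ Ψ x' (EuclideanSpace.single i 1) :=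
      (hDΨ.clm_apply contDiff_const).differentiable one_ne_zero
    have hγΨ : HasFDerivAt (fun x' => γ (Ψ x')) (deriv γ (Ψ (R y)) • fderiv ℝ Ψ (R y)) (R y) :=
      (hγd (Ψ (R y))).hasDerivAt.comp_hasFDerivAt (R y) (hΨd (R y)).hasFDerivAt
    have hmul : HasFDerivAt (fun x' => γ (Ψ x') * fderiv ℝ Ψ x' (EuclideanSpace.single i 1))
        (γ (Ψ (R y)) • fderiv ℝ (fun x' => fderiv ℝ Ψ x' (EuclideanSpace.single i 1)) (R y) +
          fderiv ℝ Ψ (R y) (EuclideanSpace.single i 1) • (deriv γ (Ψ (R y)) • fderiv ℝ Ψ (R y))) (R y) :=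
      hγΨ.mul (hud (R y)).hasFDerivAt
    rw [hmul.fderiv]
    simp only [add_apply, smul_apply, smul_eq_mul]
  have hcs : Real.cos a ^ 2 + Real.sin a ^ 2 = 1 := Real.cos_sq_add_sin_sq a
  rw [Fin.sum_univ_two, Fin.sum_univ_two, hS0, hS1, hL' 0, hL' 1]
  simp only [← hu₀_def, ← hu₁_def]
  linear_combination (deriv γ (Ψ (R y)) * (u₀ (R y) ^ 2 + u₁ (R y) ^ 2) +
    γ (Ψ (R y)) * (fderiv ℝ u₀ (R y) (EuclideanSpace.single 0 1) + fderiv ℝ u₁ (R y) (EuclideanSpace.single 1 1))) * hcs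

/-! ### The converse: profile solutions rotate into slice solutions at every height -/

/-- ★ **Rotating solutions of the slice equation from solutions of the profile equation.**  Let `Ψ : ℝ² → ℝ` be `C²`, `γ ∈ C¹`, and
suppose `Ψ` solves the rotating-pattern equation `ω² ΘΘΨ = Σᵢ ∂ᵢ(γ(Ψ)∂ᵢΨ)` on the plane (`ΘΨ(y) = DΨ(y)[Jy]`, `Jy = (−y₁, y₀)`).  Then the
rotating pattern `W(s, y) = Ψ(R_{ωs} y)` solves the autonomous slice equation at EVERY height `s` and every `y`, in the shape of
`…ZShockSliceTyping.slice_wave_pde`: `∂ₛ∂ₛW(s, y) = Σᵢ ∂ᵢ(γ(W s) ∂ᵢ(W s))(y)`.  (The converse of part I's `rotating_slice_profile_equation`.)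
[folklore] -/
theorem rotating_slice_solution_of_profile (hΨ : ContDiff ℝ 2 Ψ) (hγ : ContDiff ℝ 1 γ)
    (hJ : ∀ y' : EuclideanSpace ℝ (Fin 2), J y' = (-(y' 1)) • EuclideanSpace.single (0 : Fin 2) (1 : ℝ) +
      (y' 0) • EuclideanSpace.single (1 : Fin 2) (1 : ℝ))
    (hrot : ∀ y : EuclideanSpace ℝ (Fin 2),
      ω ^ 2 * fderiv ℝ (fun y' => fderiv ℝ Ψ y' (J y')) y (J y) =
        ∑ i, fderiv ℝ (fun y' => γ (Ψ y') * fderiv ℝ Ψ y' (EuclideanSpace.single i 1)) y (EuclideanSpace.single i 1))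
    (s : ℝ) (y : EuclideanSpace ℝ (Fin 2)) :
    deriv (fun s' => deriv (fun s'' => Ψ ((Real.cos (ω * s'') * y 0 - Real.sin (ω * s'') * y 1) •
        EuclideanSpace.single (0 : Fin 2) (1 : ℝ) +
      (Real.sin (ω * s'') * y 0 + Real.cos (ω * s'') * y 1) • EuclideanSpace.single (1 : Fin 2) (1 : ℝ))) s') s =
      ∑ i, fderiv ℝ (fun y' => γ (Ψ ((Real.cos (ω * s) * y' 0 - Real.sin (ω * s) * y' 1) •
            EuclideanSpace.single (0 : Fin 2) (1 : ℝ) +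
          (Real.sin (ω * s) * y' 0 + Real.cos (ω * s) * y' 1) • EuclideanSpace.single (1 : Fin 2) (1 : ℝ))) *
        fderiv ℝ (fun y'' => Ψ ((Real.cos (ω * s) * y'' 0 - Real.sin (ω * s) * y'' 1) •
            EuclideanSpace.single (0 : Fin 2) (1 : ℝ) +
          (Real.sin (ω * s) * y'' 0 + Real.cos (ω * s) * y'' 1) • EuclideanSpace.single (1 : Fin 2) (1 : ℝ))) y'
          (EuclideanSpace.single i 1)) y (EuclideanSpace.single i 1) := by
  -- the orbit of `y` and the rotation by the fixed angle `ω s`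
  set c : ℝ → EuclideanSpace ℝ (Fin 2) := fun s' => (Real.cos (ω * s') * y 0 - Real.sin (ω * s') * y 1) •
      EuclideanSpace.single (0 : Fin 2) (1 : ℝ) +
    (Real.sin (ω * s') * y 0 + Real.cos (ω * s') * y 1) • EuclideanSpace.single (1 : Fin 2) (1 : ℝ) with hc_def
  have hc : ∀ s', c s' = (Real.cos (ω * s') * y 0 - Real.sin (ω * s') * y 1) • EuclideanSpace.single (0 : Fin 2) (1 : ℝ) +
      (Real.sin (ω * s') * y 0 + Real.cos (ω * s') * y 1) • EuclideanSpace.single (1 : Fin 2) (1 : ℝ) := fun s' => rfl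
  set R : EuclideanSpace ℝ (Fin 2) → EuclideanSpace ℝ (Fin 2) := fun y' => (Real.cos (ω * s) * y' 0 - Real.sin (ω * s) * y' 1) •
      EuclideanSpace.single (0 : Fin 2) (1 : ℝ) +
    (Real.sin (ω * s) * y' 0 + Real.cos (ω * s) * y' 1) • EuclideanSpace.single (1 : Fin 2) (1 : ℝ) with hR_def
  have hR : ∀ y', R y' = (Real.cos (ω * s) * y' 0 - Real.sin (ω * s) * y' 1) • EuclideanSpace.single (0 : Fin 2) (1 : ℝ) +
      (Real.sin (ω * s) * y' 0 + Real.cos (ω * s) * y' 1) • EuclideanSpace.single (1 : Fin 2) (1 : ℝ) := fun y' => rfl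
  have hcR : c s = R y := rfl
  rw [deriv_deriv_comp_rotOrbit hΨ hc hJ s, divForm_comp_rot hΨ hγ hR y, hcR]
  exact hrot (R y)

end Summit.NavierStokesRegularity.NavierStokesRegularity.Theorems.PoloidalWindowDoorPoloidalWindowRigidityZShockRotatingProfileSlice
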